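import Summits.Ventures.CertifiedManyBodySolver.Observables.PairLROTowerWitness
import HarnessLib

/-!
# The Koma–Tasaki TOWER witness with a SECTOR-FLOOR clause (auxiliary conserved rows along the tower)

HONEST FRAMING: first certified bounds on pairing observables; not a superconductivity verdict. Crew hubbard-obs
(D-0042), seat hubbard-obs-p1 (`prover-hubbard-obs-p1-g14-0`). Zero compute; no definition; no named fact; no `sorry`.
Abstract finite-dimensional linear algebra (any `Matrix n n ℂ`); part 3 of PairLROTowerLemmas / PairLROTowerWitness.

`exists_towerWitness` (PairLROTowerWitness.lean) exports, for the normalised tower superposition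
`Ξ = (k+1)^{-1/2} Σ_{m=0}^{k} A^mψ/‖A^mψ‖` of a charge-raising operator `A` (`[N, A] = qA`, `q ≠ 0`) over a unit
joint eigenvector `ψ` (`Hψ = Eψ`, `Nψ = νψ`): normalisation, the one-point amplitude `≥ kρ/(k+1)`, the energy
`≤ E + D_k` of THE Hamiltonian `H`, and the exact fillings `γ + g·k/2` of every `G` with `[G, A] = gA`.
An auxiliary row of a one-point certificate that is a CONSERVED quantity `H'` (`H'N = NH'` — in the application a
Hamiltonian DIFFERENCE `H_L(θ) − H_L(θ_j)`, PairLROTowerCeilingAux) is controlled along the tower by one more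
clause, proved here by the same orthogonality bookkeeping:
* **`exists_towerWitness_aux`** — everything `exists_towerWitness` gives, AND: for every matrix `H'` with
  `H'N = NH'` and every real `F`, if `F‖A^mψ‖² ≤ Re⟨A^mψ, H'A^mψ⟩` for all `m ≤ k` (a sector floor on each
  level of the tower), then `F ≤ Re⟨Ξ, H'Ξ⟩` (the levels are `N`-eigenvectors with distinct eigenvalues, `H'`
  preserves them, so `⟨Ξ,H'Ξ⟩ = (k+1)^{-1}Σ_m ⟨Ψ^{(m)},H'Ψ^{(m)}⟩`). The upper-bound twin follows with `H' ↦ −H'`.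
References: T. Koma, H. Tasaki, J. Stat. Phys. 76 (1994) 745, §2.3 (2.21), Theorem 5, §4 [KomaTasaki1994];
T. Koma, H. Tasaki, Commun. Math. Phys. 158 (1993) 191, §6–7 [KomaTasaki1993].
-/

noncomputable section

namespace Summit.Ventures.CertifiedManyBodySolver.Observables

open Matrix Complex Finset Literature.MathematicalPhysics.QuantumLattice
open scoped ComplexOrder ComplexConjugate BigOperators

variable {n : Type*} [Fintype n] [DecidableEq n]

section Tower

variable {H Nop A : Matrix n n ℂ} {q : ℝ} {ψ : n → ℂ} {N E : ℝ}

/-- **The Koma–Tasaki tower witness with the sector-floor clause.** Let `N` be Hermitian, `H N = N H`,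
`[N, A] = qA` (`q ≠ 0`), `ψ` a unit vector with `Hψ = Eψ`, `Nψ = νψ`; assume `‖Aφ‖ ≤ α‖φ‖`,
`‖(HA − AH)φ‖ ≤ κ‖φ‖`, `|Re⟨φ,(AAᴴ − AᴴA)φ⟩| ≤ β‖φ‖²` for all `φ`, and `ρ² + kβ ≤ ‖Aψ‖²` with `ρ > 0`. Then
the normalised tower superposition `Ξ = (k+1)^{-1/2} Σ_{m=0}^{k} A^mψ/‖A^mψ‖` is a unit vector with
`Re⟨Ξ, AΞ⟩ = Re⟨Ξ, AᴴΞ⟩ ≥ kρ/(k+1)`, `Re⟨Ξ, HΞ⟩ ≤ E + (κ/ρ)Σ_{i<k}(α/ρ)^i`, `⟨Ξ, GΞ⟩ = γ + g·k/2` for every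
`G` with `[G, A] = gA`, `Gψ = γψ`, AND, for every `H'` with `H'N = NH'` and every `F` with
`F‖A^mψ‖² ≤ Re⟨A^mψ, H'A^mψ⟩` for all `m ≤ k`: `F ≤ Re⟨Ξ, H'Ξ⟩`.
[cite: KomaTasaki1994, §2.3 (2.21) and Theorem 5] -/
theorem exists_towerWitness_aux (hNop : Nop.IsHermitian) (hHN : H * Nop = Nop * H) (hq : q ≠ 0)
    (hNA : Nop * A - A * Nop = (q : ℂ) • A) (hψ1 : star ψ ⬝ᵥ ψ = 1)
    (hHψ : H *ᵥ ψ = (E : ℂ) • ψ) (hNψ : Nop *ᵥ ψ = (N : ℂ) • ψ)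
    {α κ β ρ : ℝ} (hα0 : 0 ≤ α) (hα : ∀ φ : n → ℂ, eucNorm (A *ᵥ φ) ≤ α * eucNorm φ)
    (hκ0 : 0 ≤ κ) (hκ : ∀ φ : n → ℂ, eucNorm ((H * A - A * H) *ᵥ φ) ≤ κ * eucNorm φ)
    (hβ0 : 0 ≤ β) (hβ : ∀ φ : n → ℂ, |(star φ ⬝ᵥ ((A * Aᴴ - Aᴴ * A) *ᵥ φ)).re| ≤ β * eucNorm φ ^ 2)
    (k : ℕ) (hρ : 0 < ρ) (hρ2 : ρ ^ 2 + k * β ≤ eucNorm (A *ᵥ ψ) ^ 2) :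
    ∃ Ξ : n → ℂ, star Ξ ⬝ᵥ Ξ = 1 ∧
      (k : ℝ) / (k + 1) * ρ ≤ (star Ξ ⬝ᵥ (A *ᵥ Ξ)).re ∧
      (k : ℝ) / (k + 1) * ρ ≤ (star Ξ ⬝ᵥ (Aᴴ *ᵥ Ξ)).re ∧
      (star Ξ ⬝ᵥ (H *ᵥ Ξ)).re ≤ E + (κ / ρ) * ∑ i ∈ Finset.range k, (α / ρ) ^ i ∧
      (∀ (G : Matrix n n ℂ) (g γ : ℝ), G * A - A * G = (g : ℂ) • A → G *ᵥ ψ = (γ : ℂ) • ψ →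
        star Ξ ⬝ᵥ (G *ᵥ Ξ) = ((γ + g * k / 2 : ℝ) : ℂ)) ∧
      ∀ (H' : Matrix n n ℂ) (F : ℝ), H' * Nop = Nop * H' →
        (∀ m : ℕ, m ≤ k → F * eucNorm ((A ^ m) *ᵥ ψ) ^ 2 ≤
          (star ((A ^ m) *ᵥ ψ) ⬝ᵥ (H' *ᵥ ((A ^ m) *ᵥ ψ))).re) →
        F ≤ (star Ξ ⬝ᵥ (H' *ᵥ Ξ)).re := by
  obtain ⟨hstep, hpos⟩ := tower_geom (A := A) hψ1 hβ0 hρ hβ k hρ2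
  have hdef := tower_energy_defect hψ1 hHψ hα0 hα hκ0 hκ hβ0 hρ hβ k hρ2
  -- the tower vectors and their normalisations
  set v : ℕ → n → ℂ := fun m => (A ^ m) *ᵥ ψ with hv
  set nr : ℕ → ℝ := fun m => eucNorm ((A ^ m) *ᵥ ψ) with hnr
  set u : ℕ → n → ℂ := fun m => (((nr m)⁻¹ : ℝ) : ℂ) • v m with hu
  set R : Finset ℕ := Finset.range (k + 1) with hR
  set c : ℝ := (Real.sqrt (k + 1))⁻¹ with hc
  set Ξ : n → ℂ := (c : ℂ) • ∑ m ∈ R, u m with hΞ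
  set Dk : ℝ := (κ / ρ) * ∑ i ∈ Finset.range k, (α / ρ) ^ i with hDk
  have hk1 : (0 : ℝ) < k + 1 := by positivity
  have hc2 : c ^ 2 = ((k : ℝ) + 1)⁻¹ := by
    rw [hc, inv_pow, Real.sq_sqrt hk1.le]
  have hmemR : ∀ {m}, m ∈ R → m ≤ k := fun hm => Nat.lt_succ_iff.1 (Finset.mem_range.1 hm)
  -- entries of the Gram-type sums
  have hentry : ∀ (X : Matrix n n ℂ) (m m' : ℕ), star (u m) ⬝ᵥ (X *ᵥ u m') =
      (((nr m)⁻¹ * (nr m')⁻¹ : ℝ) : ℂ) * (star (v m) ⬝ᵥ (X *ᵥ v m')) := by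
    intro X m m'
    simp only [hu, mulVec_smul, star_smul, smul_dotProduct, dotProduct_smul, smul_eq_mul,
      Complex.star_def, Complex.conj_ofReal, Complex.ofReal_mul]
    ring
  have hΞX : ∀ X : Matrix n n ℂ, star Ξ ⬝ᵥ (X *ᵥ Ξ) =
      ((c ^ 2 : ℝ) : ℂ) * ∑ m ∈ R, ∑ m' ∈ R, star (u m) ⬝ᵥ (X *ᵥ u m') := by
    intro X
    rw [hΞ, mulVec_smul, star_smul, smul_dotProduct, dotProduct_smul, star_sum_dotProduct_mulVec_sum,
      smul_eq_mul, smul_eq_mul, Complex.star_def, Complex.conj_ofReal, ← mul_assoc, ← Complex.ofReal_mul,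
      ← sq]
  -- orthogonality of the tower
  have hvv : ∀ m m', m ≠ m' → star (v m) ⬝ᵥ (v m') = 0 := fun m m' h =>
    tower_orthogonal hNop hq hNA hNψ h
  have hvself : ∀ m, star (v m) ⬝ᵥ (v m) = ((nr m ^ 2 : ℝ) : ℂ) := fun m =>
    star_dotProduct_self_eq_eucNorm_sq _
  have hrr : ∀ m, m ≤ k + 1 → ((nr m)⁻¹ * (nr m)⁻¹) * nr m ^ 2 = 1 := fun m hm => by
    have hne : nr m ≠ 0 := (hpos m hm).ne'
    rw [show (nr m)⁻¹ * (nr m)⁻¹ * nr m ^ 2 = ((nr m)⁻¹ * nr m) * ((nr m)⁻¹ * nr m) by ring,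
      inv_mul_cancel₀ hne, one_mul]
  ---------------------------------------------------------------- (1) normalisation
  have hnorm : star Ξ ⬝ᵥ Ξ = 1 := by
    have h := hΞX 1
    simp only [one_mulVec] at h
    rw [h]
    have hin : ∀ m ∈ R, ∑ m' ∈ R, star (u m) ⬝ᵥ (u m') = 1 := by
      intro m hm
      rw [Finset.sum_eq_single m]
      · have e := hentry 1 m m
        simp only [one_mulVec] at e
        rw [e, hvself, ← Complex.ofReal_mul, hrr m ((hmemR hm).trans (Nat.le_succ k)), Complex.ofReal_one]
      · intro m' _ hne
        have e := hentry 1 m m'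
        simp only [one_mulVec] at e
        rw [e, hvv m m' (Ne.symm hne), mul_zero]
      · intro h; exact absurd hm h
    rw [Finset.sum_congr rfl hin, Finset.sum_const, Finset.card_range, nsmul_eq_mul, mul_one,
      ← Complex.ofReal_natCast, ← Complex.ofReal_mul, hc2]
    push_cast
    rw [inv_mul_cancel₀ (by positivity)]
  ---------------------------------------------------------------- (2) the one-point amplitude
  have hA_entry : ∀ m m', star (u m) ⬝ᵥ (A *ᵥ u m') =
      if m = m' + 1 then (((nr (m' + 1)) / nr m' : ℝ) : ℂ) else 0 := by
    intro m m'
    rw [hentry]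
    have hv' : A *ᵥ v m' = v (m' + 1) := (tower_succ (A := A) (ψ := ψ) m').symm
    rw [hv']
    split_ifs with h
    · subst h
      rw [hvself, ← Complex.ofReal_mul]
      congr 1
      rcases (eucNorm_nonneg ((A ^ (m' + 1)) *ᵥ ψ)).lt_or_eq with hp | hz
      · field_simp
      · simp only [hnr, ← hz]; simp
    · rw [hvv m (m' + 1) h, mul_zero]
  have hTA : ∑ m ∈ R, ∑ m' ∈ R, star (u m) ⬝ᵥ (A *ᵥ u m') =
      ((∑ m' ∈ Finset.range k, nr (m' + 1) / nr m' : ℝ) : ℂ) := by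
    simp_rw [hA_entry]
    rw [Finset.sum_comm]
    have hin : ∀ m' ∈ R, ∑ m ∈ R, (if m = m' + 1 then (((nr (m' + 1)) / nr m' : ℝ) : ℂ) else 0) =
        if m' + 1 ∈ R then (((nr (m' + 1)) / nr m' : ℝ) : ℂ) else 0 := fun m' _ =>
      Finset.sum_ite_eq' R (m' + 1) _
    rw [Finset.sum_congr rfl hin, hR, Finset.sum_range_succ, Complex.ofReal_sum]
    have hlast : ((if k + 1 ∈ Finset.range (k + 1) then (((nr (k + 1)) / nr k : ℝ) : ℂ) else 0)) = 0 := by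
      rw [if_neg (by simp)]
    rw [hlast, add_zero]
    refine Finset.sum_congr rfl fun m' hm' => ?_
    rw [if_pos (Finset.mem_range.2 (by have := Finset.mem_range.1 hm'; omega))]
  have hamp : (k : ℝ) / (k + 1) * ρ ≤ (star Ξ ⬝ᵥ (A *ᵥ Ξ)).re := by
    rw [hΞX A, hTA, ← Complex.ofReal_mul, Complex.ofReal_re, hc2]
    have hsum : (k : ℝ) * ρ ≤ ∑ m' ∈ Finset.range k, nr (m' + 1) / nr m' := by
      have h : ∀ m' ∈ Finset.range k, ρ ≤ nr (m' + 1) / nr m' := by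
        intro m' hm'
        have hm'k : m' ≤ k := (Finset.mem_range.1 hm').le
        rw [le_div_iff₀ (hpos m' (by omega))]
        exact hstep m' hm'k
      have := Finset.sum_le_sum h
      rwa [Finset.sum_const, Finset.card_range, nsmul_eq_mul] at this
    rw [div_mul_eq_mul_div, div_le_iff₀ hk1]
    calc (k : ℝ) * ρ ≤ ∑ m' ∈ Finset.range k, nr (m' + 1) / nr m' := hsum
      _ = ((k : ℝ) + 1)⁻¹ * (∑ m' ∈ Finset.range k, nr (m' + 1) / nr m') * (k + 1) := by
          field_simp
  have hampH : (k : ℝ) / (k + 1) * ρ ≤ (star Ξ ⬝ᵥ (Aᴴ *ᵥ Ξ)).re := by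
    rw [dotProduct_mulVec, ← star_mulVec, star_dotProduct, Complex.star_def, Complex.conj_re]
    exact hamp
  ---------------------------------------------------------------- (3) the energy
  have hH_off : ∀ m m', m ≠ m' → star (v m) ⬝ᵥ (H *ᵥ v m') = 0 := by
    intro m m' h
    have hc1 := tower_charge (A := A) hNA hNψ m
    have hc2' := mulVec_mulVec_eigen_of_commute hHN (tower_charge (A := A) hNA hNψ m')
    refine dotProduct_eq_zero_of_eigen_ne hNop hc1 hc2' ?_
    intro h'
    have : (q : ℝ) * ((m : ℝ) - m') = 0 := by linarith
    rcases mul_eq_zero.1 this with h1 | h1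
    · exact hq h1
    · exact h (by exact_mod_cast sub_eq_zero.1 h1)
  have hDmono : ∀ m, m ≤ k → (κ / ρ) * ∑ i ∈ Finset.range m, (α / ρ) ^ i ≤ Dk := by
    intro m hm
    refine mul_le_mul_of_nonneg_left ?_ (div_nonneg hκ0 hρ.le)
    exact Finset.sum_le_sum_of_subset_of_nonneg (Finset.range_mono hm) fun i _ _ => by positivity
  have hH_diag : ∀ m, m ≤ k → (star (u m) ⬝ᵥ (H *ᵥ u m)).re ≤ E + Dk := by
    intro m hm
    rw [hentry, Complex.re_ofReal_mul]
    -- `Re⟨v m, H v m⟩ = E nr² + Re⟨v m, (H − E) v m⟩ ≤ (E + D_m) nr²`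
    have hsplit : star (v m) ⬝ᵥ (H *ᵥ v m) =
        (E : ℂ) * (star (v m) ⬝ᵥ v m) + star (v m) ⬝ᵥ (H *ᵥ v m - (E : ℂ) • v m) := by
      rw [dotProduct_sub, dotProduct_smul, smul_eq_mul]; ring
    have hre : (star (v m) ⬝ᵥ (H *ᵥ v m)).re ≤ (E + Dk) * nr m ^ 2 := by
      rw [hsplit, Complex.add_re, hvself, ← Complex.ofReal_mul, Complex.ofReal_re]
      have h1 := (le_abs_self _).trans ((Complex.abs_re_le_norm _).trans
        (norm_star_dotProduct_le (v m) (H *ᵥ v m - (E : ℂ) • v m)))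
      have h2 := hdef m hm
      have h3 : eucNorm (v m) * eucNorm (H *ᵥ v m - (E : ℂ) • v m) ≤ nr m * (Dk * nr m) :=
        mul_le_mul_of_nonneg_left (h2.trans (mul_le_mul_of_nonneg_right (hDmono m hm) (eucNorm_nonneg _)))
          (eucNorm_nonneg _)
      nlinarith [h1, h3]
    have hrr' : (nr m)⁻¹ * (nr m)⁻¹ * ((E + Dk) * nr m ^ 2) = E + Dk := by
      rw [show (nr m)⁻¹ * (nr m)⁻¹ * ((E + Dk) * nr m ^ 2) = ((nr m)⁻¹ * (nr m)⁻¹ * nr m ^ 2) * (E + Dk) by ring,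
        hrr m (hm.trans (Nat.le_succ k)), one_mul]
    have hinv : 0 ≤ (nr m)⁻¹ * (nr m)⁻¹ :=
      mul_nonneg (inv_nonneg.2 (eucNorm_nonneg _)) (inv_nonneg.2 (eucNorm_nonneg _))
    calc (nr m)⁻¹ * (nr m)⁻¹ * (star (v m) ⬝ᵥ (H *ᵥ v m)).re
        ≤ (nr m)⁻¹ * (nr m)⁻¹ * ((E + Dk) * nr m ^ 2) :=
          mul_le_mul_of_nonneg_left hre hinv
      _ = E + Dk := hrr'
  have henergy : (star Ξ ⬝ᵥ (H *ᵥ Ξ)).re ≤ E + Dk := by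
    rw [hΞX H, Complex.re_ofReal_mul, Complex.re_sum]
    have hin : ∀ m ∈ R, (∑ m' ∈ R, star (u m) ⬝ᵥ (H *ᵥ u m')).re ≤ E + Dk := by
      intro m hm
      rw [Finset.sum_eq_single m]
      · exact hH_diag m (hmemR hm)
      · intro m' _ hne
        rw [hentry, hH_off m m' (Ne.symm hne), mul_zero]
      · intro h; exact absurd hm h
    have hs := Finset.sum_le_sum hin
    rw [Finset.sum_const, Finset.card_range, nsmul_eq_mul] at hs
    rw [hc2]
    calc ((k : ℝ) + 1)⁻¹ * ∑ m ∈ R, (∑ m' ∈ R, star (u m) ⬝ᵥ (H *ᵥ u m')).re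
        ≤ ((k : ℝ) + 1)⁻¹ * ((k + 1 : ℕ) * (E + Dk)) := mul_le_mul_of_nonneg_left hs (by positivity)
      _ = E + Dk := by push_cast; field_simp
  ---------------------------------------------------------------- (4) fillings
  have hfill : ∀ (G : Matrix n n ℂ) (g γ : ℝ), G * A - A * G = (g : ℂ) • A → G *ᵥ ψ = (γ : ℂ) • ψ →
      star Ξ ⬝ᵥ (G *ᵥ Ξ) = ((γ + g * k / 2 : ℝ) : ℂ) := by
    intro G g γ hGA hGψ
    have hGv : ∀ m, G *ᵥ v m = ((γ + g * m : ℝ) : ℂ) • v m := fun m => tower_charge (A := A) hGA hGψ m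
    rw [hΞX G]
    have hin : ∀ m ∈ R, ∑ m' ∈ R, star (u m) ⬝ᵥ (G *ᵥ u m') = ((γ + g * m : ℝ) : ℂ) := by
      intro m hm
      rw [Finset.sum_eq_single m]
      · rw [hentry, hGv, dotProduct_smul, hvself, smul_eq_mul, ← Complex.ofReal_mul, ← Complex.ofReal_mul]
        congr 1
        have := hrr m ((hmemR hm).trans (Nat.le_succ k))
        calc (nr m)⁻¹ * (nr m)⁻¹ * ((γ + g * m) * nr m ^ 2) = ((nr m)⁻¹ * (nr m)⁻¹ * nr m ^ 2) * (γ + g * m) := by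
              ring
          _ = γ + g * m := by rw [this, one_mul]
      · intro m' _ hne
        rw [hentry, hGv, dotProduct_smul, hvv m m' (Ne.symm hne), smul_zero, mul_zero]
      · intro h; exact absurd hm h
    rw [Finset.sum_congr rfl hin, ← Complex.ofReal_sum, ← Complex.ofReal_mul]
    congr 1
    rw [Finset.sum_add_distrib, Finset.sum_const, Finset.card_range, nsmul_eq_mul, ← Finset.mul_sum, hc2]
    have hgauss : ∑ m ∈ R, (m : ℝ) = (k : ℝ) * (k + 1) / 2 := by
      have h := Finset.sum_range_id_mul_two (k + 1)
      have h' : ((∑ i ∈ Finset.range (k + 1), i : ℕ) : ℝ) * 2 = ((k + 1) * (k + 1 - 1) : ℕ) := by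
        exact_mod_cast h
      rw [Nat.cast_sum] at h'
      rw [hR]
      have : ((k + 1) * (k + 1 - 1) : ℕ) = (k + 1) * k := by simp
      rw [this] at h'
      push_cast at h'
      linarith
    rw [hgauss]
    push_cast
    field_simp
  ---------------------------------------------------------------- (5) sector floors of conserved rows
  have hfloor : ∀ (H' : Matrix n n ℂ) (F : ℝ), H' * Nop = Nop * H' →
      (∀ m : ℕ, m ≤ k → F * eucNorm ((A ^ m) *ᵥ ψ) ^ 2 ≤
        (star ((A ^ m) *ᵥ ψ) ⬝ᵥ (H' *ᵥ ((A ^ m) *ᵥ ψ))).re) →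
      F ≤ (star Ξ ⬝ᵥ (H' *ᵥ Ξ)).re := by
    intro H' F hH'N hF
    have hH'_off : ∀ m m', m ≠ m' → star (v m) ⬝ᵥ (H' *ᵥ v m') = 0 := by
      intro m m' h
      have hc1 := tower_charge (A := A) hNA hNψ m
      have hc2' := mulVec_mulVec_eigen_of_commute hH'N (tower_charge (A := A) hNA hNψ m')
      refine dotProduct_eq_zero_of_eigen_ne hNop hc1 hc2' ?_
      intro h'
      have : (q : ℝ) * ((m : ℝ) - m') = 0 := by linarith
      rcases mul_eq_zero.1 this with h1 | h1
      · exact hq h1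
      · exact h (by exact_mod_cast sub_eq_zero.1 h1)
    have hH'_diag : ∀ m, m ≤ k → F ≤ (star (u m) ⬝ᵥ (H' *ᵥ u m)).re := by
      intro m hm
      rw [hentry, Complex.re_ofReal_mul]
      have hre : F * nr m ^ 2 ≤ (star (v m) ⬝ᵥ (H' *ᵥ v m)).re := hF m hm
      have hrr' : (nr m)⁻¹ * (nr m)⁻¹ * (F * nr m ^ 2) = F := by
        rw [show (nr m)⁻¹ * (nr m)⁻¹ * (F * nr m ^ 2) = ((nr m)⁻¹ * (nr m)⁻¹ * nr m ^ 2) * F by ring,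
          hrr m (hm.trans (Nat.le_succ k)), one_mul]
      have hinv : 0 ≤ (nr m)⁻¹ * (nr m)⁻¹ :=
        mul_nonneg (inv_nonneg.2 (eucNorm_nonneg _)) (inv_nonneg.2 (eucNorm_nonneg _))
      calc F = (nr m)⁻¹ * (nr m)⁻¹ * (F * nr m ^ 2) := hrr'.symm
        _ ≤ (nr m)⁻¹ * (nr m)⁻¹ * (star (v m) ⬝ᵥ (H' *ᵥ v m)).re :=
            mul_le_mul_of_nonneg_left hre hinv
    rw [hΞX H', Complex.re_ofReal_mul, Complex.re_sum]
    have hin : ∀ m ∈ R, F ≤ (∑ m' ∈ R, star (u m) ⬝ᵥ (H' *ᵥ u m')).re := by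
      intro m hm
      rw [Finset.sum_eq_single m]
      · exact hH'_diag m (hmemR hm)
      · intro m' _ hne
        rw [hentry, hH'_off m m' (Ne.symm hne), mul_zero]
      · intro h; exact absurd hm h
    have hs := Finset.sum_le_sum hin
    rw [Finset.sum_const, Finset.card_range, nsmul_eq_mul] at hs
    rw [hc2]
    calc F = ((k : ℝ) + 1)⁻¹ * ((k + 1 : ℕ) * F) := by push_cast; field_simp
      _ ≤ ((k : ℝ) + 1)⁻¹ * ∑ m ∈ R, (∑ m' ∈ R, star (u m) ⬝ᵥ (H' *ᵥ u m')).re :=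
          mul_le_mul_of_nonneg_left hs (by positivity)
  exact ⟨Ξ, hnorm, hamp, hampH, henergy, hfill, hfloor⟩

end Tower

end Summit.Ventures.CertifiedManyBodySolver.Observables

end
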